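import Summits.QuantumFields.YangMills.Theorems.OneCertifiedCubeCrossoverCertificateFrozenTwist
import Summits.QuantumFields.YangMills.Theorems.OneCertifiedCubeCrossoverCertificateFrozenTrig

/-!
# The boundary Wilson action of the certified cube under the centre twist: slice lower bound and its value
# at the twist field

Helper file for the frozen-coupling analysis of crux `CrossoverCertificate` (stmt-QuantumFields-16125).
For `SU(2)` in the fundamental representation the boundary Wilson action of the cube edge set `A` is
`S_A(U) = ∑_{p ∩ A ≠ ∅} (2 - Re tr U_p)`.  Indexing the `(0,1)`-plaquettes of the slices by
`q = (σ, (u,v)) ∈ [lo,hi]² × ([0,S)² ∖ {(0,0)})` (`sitePlaquette`, an injective parametrisation of a subset of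
the plaquettes touching `A`, `FrozenGeometry`) we prove:

* `sum_slices_le_action` : `∑_q (2 - Re tr U_{p(q)}) ≤ S_A(U)` for every `U` (the other terms are `≥ 0`);
* `slice_sum_ge`, `slice_sum_ge_margin` : for `U` agreeing with the twisted boundary condition off the cube,
  each slice contributes at least `M′ (2 - 2 cos α)` (`M′ = S² - 1`, `α = π / M′`), and the slice containing a
  plaquette of angle `≤ α/2` contributes `α²/16` more (frustration `pi_le_sum_ang_slice` + concavity with margin,
  `FrozenTrig`);
* `action_ge_of_small_angle` : hence `S_A(U) ≥ K M′ (2 - 2cos α) + α²/16` whenever the designated central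
  plaquette has angle `≤ α/2` (`K` = number of slices);
* `action_twist_le` : while the twist field itself has `S_A(Uab) ≤ K M′ (2 - 2 cos α)`.

All objects enter as hypotheses; no definition is introduced.
-/

noncomputable section

namespace Summit.QuantumFields.YangMills.Theorems.CrossoverCertificate.Negative

open Finset Real
open Literature.MathematicalPhysics.QuantumLattice Literature.Probability.LatticeModels
open Summit.QuantumFields.YangMills.Theorems.CovarianceBound.Negative

section Action

variable {b n : ℕ} {A : Finset (ZdEdge 4)} {L : ℤ} {S : ℕ}
  {D : ℝ → Matrix.specialUnitaryGroup (Fin 2) ℂ} {α : ℝ}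
  {Uab U : LGConfig 4 (Matrix.specialUnitaryGroup (Fin 2) ℂ)}

/-- The plaquette observable of the fundamental representation is `Re tr` of the plaquette holonomy.
[folklore] -/
theorem plaquetteObs_fundamentalRep (U : LGConfig 4 (Matrix.specialUnitaryGroup (Fin 2) ℂ)) (x : Site 4)
    (i j : Fin 4) :
    plaquetteObs (fundamentalRep (Fin 2)) x i j U =
      (((plaquetteHolonomyZd U x i j : Matrix.specialUnitaryGroup (Fin 2) ℂ) : Matrix (Fin 2) (Fin 2) ℂ).trace).re := by
  simp [plaquetteObs]

/-- The boundary Wilson action of `SU(2)` in the fundamental representation, term by term: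
`S_A(U) = ∑_{p touching A} (2 - Re tr U_p)`. [folklore] -/
theorem wilsonBoundaryAction_fundamentalRep (A : Finset (ZdEdge 4))
    (U : LGConfig 4 (Matrix.specialUnitaryGroup (Fin 2) ℂ)) :
    wilsonBoundaryAction (fundamentalRep (Fin 2)) A U =
      ∑ p ∈ plaquettesTouching A,
        (2 - (((plaquetteHolonomyZd U p.1 p.2.1.1 p.2.1.2 : Matrix.specialUnitaryGroup (Fin 2) ℂ) :
          Matrix (Fin 2) (Fin 2) ℂ).trace).re) := by
  unfold wilsonBoundaryAction
  refine Finset.sum_congr rfl fun p _ => ?_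
  rw [plaquetteObs_fundamentalRep]
  norm_num

/-- **The slice plaquettes are distinct**: the parametrisation
`(σ, (u, v)) ↦ ((L+u, L+v, σ₂, σ₃); 0, 1)` of `(0,1)`-plaquettes is injective. [folklore] -/
theorem sitePlaquette_injective (L : ℤ) :
    Function.Injective (fun q : (ℤ × ℤ) × (ℕ × ℕ) =>
      (((Pi.single 0 L + Pi.single 1 L + Pi.single 2 q.1.1 + Pi.single 3 q.1.2 : Site 4) +
          Pi.single (0 : Fin 4) (q.2.1 : ℤ) + Pi.single (1 : Fin 4) (q.2.2 : ℤ),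
        ⟨((0 : Fin 4), (1 : Fin 4)), by decide⟩) : ZdPlaquette 4)) := by
  rintro ⟨⟨a, b⟩, ⟨u, v⟩⟩ ⟨⟨a', b'⟩, ⟨u', v'⟩⟩ h
  have hs := congrArg Prod.fst h
  simp only at hs
  have h0 := congrFun hs 0
  have h1 := congrFun hs 1
  have h2 := congrFun hs 2
  have h3 := congrFun hs 3
  simp at h0 h1 h2 h3
  subst h2; subst h3
  have hu : u = u' := by exact_mod_cast h0
  have hv : v = v' := by exact_mod_cast h1
  subst hu; subst hv; rfl

/-- **Slice sums are part of the action.** For every configuration `U`,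
`∑_{σ ∈ [lo,hi]²} ∑_{(u,v) ∈ [0,S)² ∖ {(0,0)}} (2 - Re tr U_{p(σ,u,v)}) ≤ S_A(U)`: the slice plaquettes touch the
cube (`plaquette01_mem_plaquettesTouching`), are distinct, and every other term of `S_A` is non-negative.
[folklore] -/
theorem sum_slices_le_action (hb : 0 < b)
    (hA : A = (Finset.biUnion (Fintype.piFinset fun _ : Fin 4 => Finset.Icc (-(2 * ((n : ℕ) : ℤ))) (2 * ((n : ℕ) : ℤ))) (fun y : Fin 4 → ℤ => (Fintype.piFinset fun i : Fin 4 => Finset.Ico (((b : ℕ) : ℤ) * y i) (((b : ℕ) : ℤ) * (y i + 1))) ×ˢ (Finset.univ : Finset (Fin 4)))))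
    (hL : L = -(2 * (n : ℤ) * b) - 1) (hS : S = (4 * n + 1) * b + 1)
    (U : LGConfig 4 (Matrix.specialUnitaryGroup (Fin 2) ℂ)) :
    ∑ σ ∈ Finset.Icc (L + 1) (L + S - 1) ×ˢ Finset.Icc (L + 1) (L + S - 1),
      ∑ uv ∈ ((Finset.range S) ×ˢ (Finset.range S)).erase (0, 0),
        (2 - (((plaquetteHolonomyZd U ((Pi.single 0 L + Pi.single 1 L + Pi.single 2 σ.1 + Pi.single 3 σ.2 : Site 4) +
          Pi.single 0 (uv.1 : ℤ) + Pi.single 1 (uv.2 : ℤ)) 0 1 : Matrix.specialUnitaryGroup (Fin 2) ℂ) :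
            Matrix (Fin 2) (Fin 2) ℂ).trace).re)
      ≤ wilsonBoundaryAction (fundamentalRep (Fin 2)) A U := by
  rw [wilsonBoundaryAction_fundamentalRep, ← Finset.sum_product']
  -- rewrite the double sum as a sum over the image of the injective parametrisation
  rw [← Finset.sum_image (f := fun p : ZdPlaquette 4 =>
      (2 - (((plaquetteHolonomyZd U p.1 p.2.1.1 p.2.1.2 : Matrix.specialUnitaryGroup (Fin 2) ℂ) :
        Matrix (Fin 2) (Fin 2) ℂ).trace).re))
      (fun q _ q' _ h => sitePlaquette_injective L h)]
  refine Finset.sum_le_sum_of_subset_of_nonneg ?_ (fun p _ _ => two_sub_trace_re_nonneg _)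
  intro p hp
  rw [Finset.mem_image] at hp
  obtain ⟨⟨σ, uv⟩, hq, rfl⟩ := hp
  rw [Finset.mem_product] at hq
  obtain ⟨hσ, huv⟩ := hq
  subst hL; subst hS
  rw [hA]
  refine plaquette01_mem_plaquettesTouching hb ?_ huv
  simp only [Finset.mem_product, Finset.mem_Icc] at hσ ⊢
  push_cast at hσ ⊢
  refine ⟨⟨by linarith [hσ.1.1], by linarith [hσ.1.2]⟩, by linarith [hσ.2.1], by linarith [hσ.2.2]⟩

/-- The number of non-corner slice plaquettes is `S² - 1`. [folklore] -/
theorem card_slicePlaquettes : ∀ {S : ℕ}, 1 ≤ S → (((Finset.range S) ×ˢ (Finset.range S)).erase ((0 : ℕ), (0 : ℕ))).card = S * S - 1 := by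
  intro S hS1
  rw [Finset.card_erase_of_mem (Finset.mem_product.2 ⟨Finset.mem_range.2 (by omega), Finset.mem_range.2 (by omega)⟩),
    Finset.card_product, Finset.card_range]

/-- **Each slice costs at least `M′ (2 - 2 cos (π/M′))`** (`M′ = S² - 1 ≥ 120`) for a configuration agreeing
with the twisted boundary condition off the cube: the slice angles sum to `≥ π` and `cos` is concave.
[folklore] -/
theorem slice_sum_ge (hb : 0 < b)
    (hA : A = (Finset.biUnion (Fintype.piFinset fun _ : Fin 4 => Finset.Icc (-(2 * ((n : ℕ) : ℤ))) (2 * ((n : ℕ) : ℤ))) (fun y : Fin 4 → ℤ => (Fintype.piFinset fun i : Fin 4 => Finset.Ico (((b : ℕ) : ℤ) * y i) (((b : ℕ) : ℤ) * (y i + 1))) ×ˢ (Finset.univ : Finset (Fin 4)))))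
    (hL : L = -(2 * (n : ℤ) * b) - 1) (hS : S = (4 * n + 1) * b + 1)
    (hD : ∀ s t : ℝ, D (s + t) = D s * D t) (hD0 : D 0 = 1) (hDπ : ang (D (α * ((S : ℝ) * S - 1))) = π)
    (hUab : ∀ (y : Site 4) (μ : Fin 4), Uab (y, μ) =
      if μ = 1 then D (α * (((y 0 - L : ℤ) : ℝ) - if y 1 = L ∧ L + 1 ≤ y 0 then 1 else 0)) else 1)
    (hU : ∀ e, e ∉ A → U e = Uab e)
    (hcard : 120 ≤ (((Finset.range S) ×ˢ (Finset.range S)).erase ((0 : ℕ), (0 : ℕ))).card) (σ : ℤ × ℤ) :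
    ((((Finset.range S) ×ˢ (Finset.range S)).erase ((0 : ℕ), (0 : ℕ))).card : ℝ) *
        (2 - 2 * Real.cos (π / (((Finset.range S) ×ˢ (Finset.range S)).erase ((0 : ℕ), (0 : ℕ))).card)) ≤
      ∑ uv ∈ ((Finset.range S) ×ˢ (Finset.range S)).erase (0, 0),
        (2 - (((plaquetteHolonomyZd U ((Pi.single 0 L + Pi.single 1 L + Pi.single 2 σ.1 + Pi.single 3 σ.2 : Site 4) +
          Pi.single 0 (uv.1 : ℤ) + Pi.single 1 (uv.2 : ℤ)) 0 1 : Matrix.specialUnitaryGroup (Fin 2) ℂ) :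
            Matrix (Fin 2) (Fin 2) ℂ).trace).re) := by
  have hπ := pi_le_sum_ang_slice hb hA hL hS hD hD0 hDπ hUab hU σ
  have hT : ((((Finset.range S) ×ˢ (Finset.range S)).erase ((0 : ℕ), (0 : ℕ))).card : ℝ) *
      (1 - Real.cos (π / (((Finset.range S) ×ˢ (Finset.range S)).erase ((0 : ℕ), (0 : ℕ))).card)) ≤
      ∑ uv ∈ ((Finset.range S) ×ˢ (Finset.range S)).erase ((0 : ℕ), (0 : ℕ)),
        (1 - Real.cos (ang (plaquetteHolonomyZd U
          ((Pi.single 0 L + Pi.single 1 L + Pi.single 2 σ.1 + Pi.single 3 σ.2 : Site 4) +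
            Pi.single 0 (uv.1 : ℤ) + Pi.single 1 (uv.2 : ℤ)) 0 1))) :=
    sum_one_sub_cos_ge _ _ hcard (fun p _ => ⟨ang_nonneg _, ang_le_pi _⟩) hπ
  have hrw : ∀ uv ∈ ((Finset.range S) ×ˢ (Finset.range S)).erase ((0 : ℕ), (0 : ℕ)),
      (2 - (((plaquetteHolonomyZd U ((Pi.single 0 L + Pi.single 1 L + Pi.single 2 σ.1 + Pi.single 3 σ.2 : Site 4) +
          Pi.single 0 (uv.1 : ℤ) + Pi.single 1 (uv.2 : ℤ)) 0 1 : Matrix.specialUnitaryGroup (Fin 2) ℂ) :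
            Matrix (Fin 2) (Fin 2) ℂ).trace).re) =
        2 * (1 - Real.cos (ang (plaquetteHolonomyZd U
          ((Pi.single 0 L + Pi.single 1 L + Pi.single 2 σ.1 + Pi.single 3 σ.2 : Site 4) +
            Pi.single 0 (uv.1 : ℤ) + Pi.single 1 (uv.2 : ℤ)) 0 1))) :=
    fun uv _ => two_sub_trace_re_eq _
  rw [Finset.sum_congr rfl hrw, ← Finset.mul_sum]
  calc ((((Finset.range S) ×ˢ (Finset.range S)).erase ((0 : ℕ), (0 : ℕ))).card : ℝ) *
        (2 - 2 * Real.cos (π / (((Finset.range S) ×ˢ (Finset.range S)).erase ((0 : ℕ), (0 : ℕ))).card))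
      = 2 * (((((Finset.range S) ×ˢ (Finset.range S)).erase ((0 : ℕ), (0 : ℕ))).card : ℝ) *
        (1 - Real.cos (π / (((Finset.range S) ×ˢ (Finset.range S)).erase ((0 : ℕ), (0 : ℕ))).card))) := by ring
    _ ≤ _ := mul_le_mul_of_nonneg_left hT (by norm_num)

/-- **The slice with a small angle costs `α²/16` more** (`α = π/M′`): if one of its plaquettes has angle
`≤ α/2`, the slice contributes at least `M′ (2 - 2 cos α) + α²/16`. [folklore] -/
theorem slice_sum_ge_margin (hb : 0 < b)
    (hA : A = (Finset.biUnion (Fintype.piFinset fun _ : Fin 4 => Finset.Icc (-(2 * ((n : ℕ) : ℤ))) (2 * ((n : ℕ) : ℤ))) (fun y : Fin 4 → ℤ => (Fintype.piFinset fun i : Fin 4 => Finset.Ico (((b : ℕ) : ℤ) * y i) (((b : ℕ) : ℤ) * (y i + 1))) ×ˢ (Finset.univ : Finset (Fin 4)))))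
    (hL : L = -(2 * (n : ℤ) * b) - 1) (hS : S = (4 * n + 1) * b + 1)
    (hD : ∀ s t : ℝ, D (s + t) = D s * D t) (hD0 : D 0 = 1) (hDπ : ang (D (α * ((S : ℝ) * S - 1))) = π)
    (hUab : ∀ (y : Site 4) (μ : Fin 4), Uab (y, μ) =
      if μ = 1 then D (α * (((y 0 - L : ℤ) : ℝ) - if y 1 = L ∧ L + 1 ≤ y 0 then 1 else 0)) else 1)
    (hU : ∀ e, e ∉ A → U e = Uab e)
    (hcard : 120 ≤ (((Finset.range S) ×ˢ (Finset.range S)).erase ((0 : ℕ), (0 : ℕ))).card) (σ : ℤ × ℤ)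
    {uv₀ : ℕ × ℕ} (huv₀ : uv₀ ∈ ((Finset.range S) ×ˢ (Finset.range S)).erase ((0 : ℕ), (0 : ℕ)))
    (hsmall : ang (plaquetteHolonomyZd U ((Pi.single 0 L + Pi.single 1 L + Pi.single 2 σ.1 + Pi.single 3 σ.2 : Site 4) +
      Pi.single 0 (uv₀.1 : ℤ) + Pi.single 1 (uv₀.2 : ℤ)) 0 1) ≤
        π / (((Finset.range S) ×ˢ (Finset.range S)).erase ((0 : ℕ), (0 : ℕ))).card / 2) :
    ((((Finset.range S) ×ˢ (Finset.range S)).erase ((0 : ℕ), (0 : ℕ))).card : ℝ) *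
        (2 - 2 * Real.cos (π / (((Finset.range S) ×ˢ (Finset.range S)).erase ((0 : ℕ), (0 : ℕ))).card)) +
        (π / (((Finset.range S) ×ˢ (Finset.range S)).erase ((0 : ℕ), (0 : ℕ))).card) ^ 2 / 16 ≤
      ∑ uv ∈ ((Finset.range S) ×ˢ (Finset.range S)).erase (0, 0),
        (2 - (((plaquetteHolonomyZd U ((Pi.single 0 L + Pi.single 1 L + Pi.single 2 σ.1 + Pi.single 3 σ.2 : Site 4) +
          Pi.single 0 (uv.1 : ℤ) + Pi.single 1 (uv.2 : ℤ)) 0 1 : Matrix.specialUnitaryGroup (Fin 2) ℂ) :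
            Matrix (Fin 2) (Fin 2) ℂ).trace).re) := by
  have hπ := pi_le_sum_ang_slice hb hA hL hS hD hD0 hDπ hUab hU σ
  have hT : ((((Finset.range S) ×ˢ (Finset.range S)).erase ((0 : ℕ), (0 : ℕ))).card : ℝ) *
      (1 - Real.cos (π / (((Finset.range S) ×ˢ (Finset.range S)).erase ((0 : ℕ), (0 : ℕ))).card)) +
      (π / (((Finset.range S) ×ˢ (Finset.range S)).erase ((0 : ℕ), (0 : ℕ))).card) ^ 2 / 32 ≤
      ∑ uv ∈ ((Finset.range S) ×ˢ (Finset.range S)).erase ((0 : ℕ), (0 : ℕ)),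
        (1 - Real.cos (ang (plaquetteHolonomyZd U
          ((Pi.single 0 L + Pi.single 1 L + Pi.single 2 σ.1 + Pi.single 3 σ.2 : Site 4) +
            Pi.single 0 (uv.1 : ℤ) + Pi.single 1 (uv.2 : ℤ)) 0 1))) :=
    sum_one_sub_cos_ge_margin _ _ hcard (fun p _ => ⟨ang_nonneg _, ang_le_pi _⟩) hπ huv₀ hsmall
  have hrw : ∀ uv ∈ ((Finset.range S) ×ˢ (Finset.range S)).erase ((0 : ℕ), (0 : ℕ)),
      (2 - (((plaquetteHolonomyZd U ((Pi.single 0 L + Pi.single 1 L + Pi.single 2 σ.1 + Pi.single 3 σ.2 : Site 4) +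
          Pi.single 0 (uv.1 : ℤ) + Pi.single 1 (uv.2 : ℤ)) 0 1 : Matrix.specialUnitaryGroup (Fin 2) ℂ) :
            Matrix (Fin 2) (Fin 2) ℂ).trace).re) =
        2 * (1 - Real.cos (ang (plaquetteHolonomyZd U
          ((Pi.single 0 L + Pi.single 1 L + Pi.single 2 σ.1 + Pi.single 3 σ.2 : Site 4) +
            Pi.single 0 (uv.1 : ℤ) + Pi.single 1 (uv.2 : ℤ)) 0 1))) :=
    fun uv _ => two_sub_trace_re_eq _
  rw [Finset.sum_congr rfl hrw, ← Finset.mul_sum]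
  calc ((((Finset.range S) ×ˢ (Finset.range S)).erase ((0 : ℕ), (0 : ℕ))).card : ℝ) *
        (2 - 2 * Real.cos (π / (((Finset.range S) ×ˢ (Finset.range S)).erase ((0 : ℕ), (0 : ℕ))).card)) +
        (π / (((Finset.range S) ×ˢ (Finset.range S)).erase ((0 : ℕ), (0 : ℕ))).card) ^ 2 / 16
      = 2 * (((((Finset.range S) ×ˢ (Finset.range S)).erase ((0 : ℕ), (0 : ℕ))).card : ℝ) *
        (1 - Real.cos (π / (((Finset.range S) ×ˢ (Finset.range S)).erase ((0 : ℕ), (0 : ℕ))).card)) +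
        (π / (((Finset.range S) ×ˢ (Finset.range S)).erase ((0 : ℕ), (0 : ℕ))).card) ^ 2 / 32) := by ring
    _ ≤ _ := mul_le_mul_of_nonneg_left hT (by norm_num)

/-- **Action lower bound on the small-angle event.** If `U` agrees with the twisted boundary condition off the
cube and its `(0,1)`-plaquette at the slice site `(σ₀, uv₀)` has angle `≤ α/2`, then
`S_A(U) ≥ K · M′ (2 - 2 cos α) + α²/16`, `K = (S-1)²` the number of slices. [folklore] -/
theorem action_ge_of_small_angle (hb : 0 < b)
    (hA : A = (Finset.biUnion (Fintype.piFinset fun _ : Fin 4 => Finset.Icc (-(2 * ((n : ℕ) : ℤ))) (2 * ((n : ℕ) : ℤ))) (fun y : Fin 4 → ℤ => (Fintype.piFinset fun i : Fin 4 => Finset.Ico (((b : ℕ) : ℤ) * y i) (((b : ℕ) : ℤ) * (y i + 1))) ×ˢ (Finset.univ : Finset (Fin 4)))))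
    (hL : L = -(2 * (n : ℤ) * b) - 1) (hS : S = (4 * n + 1) * b + 1)
    (hD : ∀ s t : ℝ, D (s + t) = D s * D t) (hD0 : D 0 = 1) (hDπ : ang (D (α * ((S : ℝ) * S - 1))) = π)
    (hUab : ∀ (y : Site 4) (μ : Fin 4), Uab (y, μ) =
      if μ = 1 then D (α * (((y 0 - L : ℤ) : ℝ) - if y 1 = L ∧ L + 1 ≤ y 0 then 1 else 0)) else 1)
    (hU : ∀ e, e ∉ A → U e = Uab e)
    (hcard : 120 ≤ (((Finset.range S) ×ˢ (Finset.range S)).erase ((0 : ℕ), (0 : ℕ))).card)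
    {σ₀ : ℤ × ℤ} (hσ₀ : σ₀ ∈ Finset.Icc (L + 1) (L + S - 1) ×ˢ Finset.Icc (L + 1) (L + S - 1))
    {uv₀ : ℕ × ℕ} (huv₀ : uv₀ ∈ ((Finset.range S) ×ˢ (Finset.range S)).erase ((0 : ℕ), (0 : ℕ)))
    (hsmall : ang (plaquetteHolonomyZd U ((Pi.single 0 L + Pi.single 1 L + Pi.single 2 σ₀.1 + Pi.single 3 σ₀.2 : Site 4) +
      Pi.single 0 (uv₀.1 : ℤ) + Pi.single 1 (uv₀.2 : ℤ)) 0 1) ≤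
        π / (((Finset.range S) ×ˢ (Finset.range S)).erase ((0 : ℕ), (0 : ℕ))).card / 2) :
    ((Finset.Icc (L + 1) (L + S - 1) ×ˢ Finset.Icc (L + 1) (L + S - 1)).card : ℝ) *
        (((((Finset.range S) ×ˢ (Finset.range S)).erase ((0 : ℕ), (0 : ℕ))).card : ℝ) *
          (2 - 2 * Real.cos (π / (((Finset.range S) ×ˢ (Finset.range S)).erase ((0 : ℕ), (0 : ℕ))).card))) +
        (π / (((Finset.range S) ×ˢ (Finset.range S)).erase ((0 : ℕ), (0 : ℕ))).card) ^ 2 / 16 ≤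
      wilsonBoundaryAction (fundamentalRep (Fin 2)) A U := by
  refine le_trans ?_ (sum_slices_le_action hb hA hL hS U)
  set M : ℝ := ((((Finset.range S) ×ˢ (Finset.range S)).erase ((0 : ℕ), (0 : ℕ))).card : ℝ) *
    (2 - 2 * Real.cos (π / (((Finset.range S) ×ˢ (Finset.range S)).erase ((0 : ℕ), (0 : ℕ))).card)) with hM
  set m : ℝ := (π / (((Finset.range S) ×ˢ (Finset.range S)).erase ((0 : ℕ), (0 : ℕ))).card) ^ 2 / 16 with hm
  calc ((Finset.Icc (L + 1) (L + S - 1) ×ˢ Finset.Icc (L + 1) (L + S - 1)).card : ℝ) * M + m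
      = ∑ σ ∈ Finset.Icc (L + 1) (L + S - 1) ×ˢ Finset.Icc (L + 1) (L + S - 1),
          (M + if σ = σ₀ then m else 0) := by
        rw [Finset.sum_add_distrib, Finset.sum_const, nsmul_eq_mul, Finset.sum_ite_eq' _ σ₀, if_pos hσ₀]
    _ ≤ _ := by
        refine Finset.sum_le_sum fun σ _ => ?_
        by_cases hσ : σ = σ₀
        · rw [if_pos hσ, hσ]
          exact slice_sum_ge_margin hb hA hL hS hD hD0 hDπ hUab hU hcard σ₀ huv₀ hsmall
        · rw [if_neg hσ, add_zero]
          exact slice_sum_ge hb hA hL hS hD hD0 hDπ hUab hU hcard σ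

/-- **The action of the twist field.** Every plaquette touching the cube contributes `0` to `S_A(Uab)` unless it
is one of the (non-corner) slice plaquettes, which contribute `2 - 2 cos α` each; hence
`S_A(Uab) ≤ K · M′ (2 - 2 cos α)`. [folklore] -/
theorem action_twist_le (hb : 0 < b)
    (hA : A = (Finset.biUnion (Fintype.piFinset fun _ : Fin 4 => Finset.Icc (-(2 * ((n : ℕ) : ℤ))) (2 * ((n : ℕ) : ℤ))) (fun y : Fin 4 → ℤ => (Fintype.piFinset fun i : Fin 4 => Finset.Ico (((b : ℕ) : ℤ) * y i) (((b : ℕ) : ℤ) * (y i + 1))) ×ˢ (Finset.univ : Finset (Fin 4)))))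
    (hL : L = -(2 * (n : ℤ) * b) - 1) (hS : S = (4 * n + 1) * b + 1)
    (hD : ∀ s t : ℝ, D (s + t) = D s * D t) (hD0 : D 0 = 1)
    (hα0 : 0 ≤ α) (hαπ : α ≤ π) (hDα : ∀ t : ℝ, 0 ≤ t → t ≤ π → ang (D t) = t)
    (hUab : ∀ (y : Site 4) (μ : Fin 4), Uab (y, μ) =
      if μ = 1 then D (α * (((y 0 - L : ℤ) : ℝ) - if y 1 = L ∧ L + 1 ≤ y 0 then 1 else 0)) else 1) :
    wilsonBoundaryAction (fundamentalRep (Fin 2)) A Uab ≤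
      ((Finset.Icc (L + 1) (L + S - 1) ×ˢ Finset.Icc (L + 1) (L + S - 1)).card : ℝ) *
        (((((Finset.range S) ×ˢ (Finset.range S)).erase ((0 : ℕ), (0 : ℕ))).card : ℝ) * (2 - 2 * Real.cos α)) := by
  classical
  rw [wilsonBoundaryAction_fundamentalRep]
  set dom := (Finset.Icc (L + 1) (L + S - 1) ×ˢ Finset.Icc (L + 1) (L + S - 1)) ×ˢ
    (((Finset.range S) ×ˢ (Finset.range S)).erase ((0 : ℕ), (0 : ℕ))) with hdom
  set ι : (ℤ × ℤ) × (ℕ × ℕ) → ZdPlaquette 4 := fun q =>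
      (((Pi.single 0 L + Pi.single 1 L + Pi.single 2 q.1.1 + Pi.single 3 q.1.2 : Site 4) +
          Pi.single (0 : Fin 4) (q.2.1 : ℤ) + Pi.single (1 : Fin 4) (q.2.2 : ℤ),
        ⟨((0 : Fin 4), (1 : Fin 4)), by decide⟩) : ZdPlaquette 4) with hι
  -- pointwise: a touching plaquette contributes ≤ (2 - 2cos α) if it is a slice plaquette, and 0 otherwise
  have hpt : ∀ p ∈ plaquettesTouching A,
      (2 - (((plaquetteHolonomyZd Uab p.1 p.2.1.1 p.2.1.2 : Matrix.specialUnitaryGroup (Fin 2) ℂ) :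
          Matrix (Fin 2) (Fin 2) ℂ).trace).re) ≤ if p ∈ dom.image ι then (2 - 2 * Real.cos α) else 0 := by
    intro p hp
    by_cases hmem : p ∈ dom.image ι
    · rw [if_pos hmem]
      obtain ⟨q, hq, rfl⟩ := Finset.mem_image.1 hmem
      rw [hdom, Finset.mem_product, Finset.mem_product] at hq
      obtain ⟨⟨-, -⟩, huv⟩ := hq
      rw [Finset.mem_erase, Finset.mem_product] at huv
      have hne : ¬ (q.2.1 = 0 ∧ q.2.2 = 0) := fun h => huv.1 (Prod.ext h.1 h.2)
      simp only [hι]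
      rw [plaquetteHolonomyZd_twist_01 hD hD0 hUab, two_sub_trace_re_eq, hDα α hα0 hαπ]
      · exact le_of_eq (by ring)
      · simp
      · simpa using hne
    · rw [if_neg hmem]
      -- not a slice plaquette: either another plane (flat) or a (0,1)-plaquette outside the slices (impossible)
      obtain ⟨x, ⟨⟨i, j⟩, hij⟩⟩ := p
      by_cases h01 : (i, j) = ((0 : Fin 4), (1 : Fin 4))
      · exfalso
        simp only [Prod.mk.injEq] at h01
        obtain ⟨rfl, rfl⟩ := h01
        subst hL; subst hS
        rw [hA] at hp
        obtain ⟨h2, h3, h0, h1, hc⟩ := bounds_of_plaquette01_mem_plaquettesTouching hb hp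
        obtain ⟨u, hu⟩ := Int.eq_ofNat_of_zero_le (sub_nonneg.2 h0.1)
        obtain ⟨v, hv⟩ := Int.eq_ofNat_of_zero_le (sub_nonneg.2 h1.1)
        apply hmem
        rw [Finset.mem_image]
        refine ⟨((x 2, x 3), (u, v)), ?_, ?_⟩
        · simp only [hdom, Finset.mem_product, Finset.mem_Icc, Finset.mem_erase, Finset.mem_range, ne_eq,
            Prod.mk.injEq]
          refine ⟨⟨⟨by linarith [h2.1], by push_cast; linarith [h2.2]⟩, by linarith [h3.1],
            by push_cast; linarith [h3.2]⟩, ?_, ?_, ?_⟩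
          · rintro ⟨rfl, rfl⟩
            push_cast at hu hv
            exact hc ⟨by linarith, by linarith⟩
          · have : (u : ℤ) < (((4 * n + 1) * b + 1 : ℕ) : ℤ) := by push_cast; linarith [h0.2]
            exact_mod_cast this
          · have : (v : ℤ) < (((4 * n + 1) * b + 1 : ℕ) : ℤ) := by push_cast; linarith [h1.2]
            exact_mod_cast this
        · simp only [hι]
          congr 1
          ext k
          fin_cases k <;> simp <;> linarith
      · rw [plaquetteHolonomyZd_twist_of_ne hUab x hij h01]
        simp
  calc ∑ p ∈ plaquettesTouching A,
        (2 - (((plaquetteHolonomyZd Uab p.1 p.2.1.1 p.2.1.2 : Matrix.specialUnitaryGroup (Fin 2) ℂ) :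
          Matrix (Fin 2) (Fin 2) ℂ).trace).re)
      ≤ ∑ p ∈ plaquettesTouching A, (if p ∈ dom.image ι then (2 - 2 * Real.cos α) else 0) := Finset.sum_le_sum hpt
    _ = ((plaquettesTouching A).filter (· ∈ dom.image ι)).card * (2 - 2 * Real.cos α) := by
        rw [Finset.sum_ite, Finset.sum_const_zero, add_zero, Finset.sum_const, nsmul_eq_mul]
    _ ≤ (dom.image ι).card * (2 - 2 * Real.cos α) := by
        have hcos := Real.cos_le_one α
        gcongr
        · linarith
        · exact fun p hp => (Finset.mem_filter.1 hp).2
    _ ≤ dom.card * (2 - 2 * Real.cos α) := by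
        have hcos := Real.cos_le_one α
        gcongr
        · linarith
        · exact Finset.card_image_le
    _ = _ := by rw [hdom, Finset.card_product]; push_cast; ring

end Action

end Summit.QuantumFields.YangMills.Theorems.CrossoverCertificate.Negative

end
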